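import Mathlib
import HarnessLib
import Summits.Ventures.LatticeQCDFlow.Scoring.ReversibleKernelTauIntFloor
import Summits.Ventures.LatticeQCDFlow.Scoring.IndepMHKernelPositive
import Summits.Ventures.LatticeQCDFlow.Exactness.ApproxTrivializingSampler

/-!
# Cross-covariances of a positive reversible sampler are dominated by the autocovariances at the
# same lag: `C_{uv}(t)² ≤ C_u(t) · C_v(t)` — for the flow-MCMC kernel at every lag, UNCONDITIONALLY
# on `SU(n)^E`

HONEST FRAMING: exact (Metropolis-corrected) sampling algorithms for lattice gauge theory;
figures of merit are autocorrelation/cost numbers at stated couplings and volumes; no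
continuum-physics claim.

Venture `LatticeQCDFlow` (cell pub-lqcd), topic `Scoring`; FANOUT row 8 (`s0-cpn-nemc`, GEN-13).
NEW WORK of the cell, not a published result; no definition is introduced.  Inputs, all tree
files: reversibility on observables and row 2's abstract operator calculus
(`Scoring/ReversibleKernelTauIntFloor.lean`: `integral_kop_mul_comm_of_isReversible`, `kop_opBdd`,
`kop_opLin`, `kop_opSymm`; `Exactness/ReversibleTauIntFloor.lean`: `op_iterate_add_mul`,
`op_two_time`), positivity of the flow-MCMC kernel (`Scoring/IndepMHKernelPositive.lean`:
`indepMH_autocov_nonneg`, row 2's `imhOp` positivity through row 8's dictionary), and the exact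
flow sampler (`Exactness/ApproxTrivializingSampler.lean`: `flowSampler_exact_doeblin`).  Printed
counterpart NAMED ONLY: the Cauchy–Schwarz inequality for the positive semidefinite form
`⟨u, Kᵗ v⟩_π` of a positive self-adjoint Markov operator (Liu 1996 for independence samplers;
textbook); nothing is cited as a fact.

## Content (`κ` Markov, `π`-REVERSIBLE for a probability law `π`; `u, v` bounded measurable;
## `C_{uv}(t) := ∫ u · (kop κ)^[t] v dπ`, `C_u(t) = autocov κ π u t`)

* **`integral_mul_iterate_kop_comm_of_isReversible`** — symmetry at every lag:
  `∫ u · Kᵗ v dπ = ∫ v · Kᵗ u dπ`;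
* `autocov_add_mul` — the quadratic form expands:
  `C_{u + λv}(t) = C_u(t) + 2λ C_{uv}(t) + λ² C_v(t)`;
* **`autocov_nonneg_of_kop_nonneg`** — one-step positivity (`∫ g · K g dπ ≥ 0` for every bounded
  measurable `g`) propagates to EVERY lag: `0 ≤ C_g(t)` (even lags are squares, odd lags are
  one-step forms of `K^m g`);
* **`sq_crossCov_le_of_autocov_nonneg`** — CAUCHY–SCHWARZ AT LAG `t`: if `C_g(t) ≥ 0` for every
  bounded measurable `g`, then `C_{uv}(t)² ≤ C_u(t) C_v(t)`; `abs_crossCov_le_sqrt_of_autocov_nonneg`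
  — `|C_{uv}(t)| ≤ √(C_u(t) C_v(t))`;
* **`indepMH_sq_crossCov_le`**, `indepMH_abs_crossCov_le_sqrt` — for the flow-MCMC kernel
  `indepMH q w` with target `π = w · q` (any measurable space): at EVERY lag and for EVERY pair of
  bounded measurable observables, `C_{uv}(t)² ≤ C_u(t) C_v(t)`;
* **`flowSampler_sq_crossCov_le`** — the lattice instance, UNCONDITIONAL on `SU(n)^E` (hypotheses of
  `Scoring.flowSampler_autocorrelation`).

Reading (value-free): for the exact flow sampler the lag-`t` covariance matrix of any family of
observables is symmetric positive semidefinite at every lag — an observable that has decorrelated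
(`C_u(t)` small) has decorrelated FROM EVERYTHING, and the slowest autocovariance in a family bounds
every cross term; a testable structural prediction for multi-observable autocorrelation analyses,
false in general for HMC / heat bath / non-reversible sweeps.  NOT CLAIMED: positivity for any
sampler other than independence Metropolis; unbounded observables; estimator statements; any
number of ours.
-/

noncomputable section

namespace Summit.Ventures.LatticeQCDFlow.Scoring

open MeasureTheory ProbabilityTheory Filter Finset Summit.Ventures.LatticeQCDFlow.Exactness
open scoped ENNReal

variable {Ω : Type*} [MeasurableSpace Ω]

/-! ### Symmetry at every lag and the quadratic form -/

section Reversible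

variable {κ : Kernel Ω Ω} [IsMarkovKernel κ] {π : Measure Ω} [IsProbabilityMeasure π]

/-- **Symmetry at every lag**: for a `π`-reversible Markov kernel and bounded measurable `u, v`,
`∫ u · (kop κ)^[t] v dπ = ∫ v · (kop κ)^[t] u dπ`. -/
theorem integral_mul_iterate_kop_comm_of_isReversible (hrev : Kernel.IsReversible κ π) {Bu Bv : ℝ} :
    ∀ (t : ℕ) {u v : Ω → ℝ}, Measurable u → Measurable v → (∀ x, |u x| ≤ Bu) → (∀ x, |v x| ≤ Bv) →
      ∫ x, u x * (kop κ)^[t] v x ∂π = ∫ x, v x * (kop κ)^[t] u x ∂π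
  | 0, u, v, _, _, _, _ => integral_congr_ae (ae_of_all _ fun x => by
      simp only [Function.iterate_zero, id]; exact mul_comm _ _)
  | t + 1, u, v, hu, hv, hBu, hBv => by
    obtain ⟨hUm, hUb⟩ := iterate_kop_bounded_measurable κ hu hBu t
    calc ∫ x, u x * (kop κ)^[t + 1] v x ∂π = ∫ x, u x * (kop κ)^[t] (kop κ v) x ∂π := by
          simp only [Function.iterate_succ_apply]
      _ = ∫ x, kop κ v x * (kop κ)^[t] u x ∂π :=
          integral_mul_iterate_kop_comm_of_isReversible hrev t hu (measurable_kop κ hv) hBu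
            (abs_kop_le κ hBv)
      _ = ∫ x, v x * kop κ ((kop κ)^[t] u) x ∂π :=
          integral_kop_mul_comm_of_isReversible κ hrev hv hUm hBv hUb
      _ = ∫ x, v x * (kop κ)^[t + 1] u x ∂π := by simp only [Function.iterate_succ_apply']

/-- **The quadratic form expands**: `C_{u + λv}(t) = C_u(t) + 2λ C_{uv}(t) + λ² C_v(t)` for a
`π`-reversible kernel and bounded measurable `u, v`. -/
theorem autocov_add_mul (hrev : Kernel.IsReversible κ π) {u v : Ω → ℝ} (hu : Measurable u)
    (hv : Measurable v) {Bu Bv : ℝ} (hBu : ∀ x, |u x| ≤ Bu) (hBv : ∀ x, |v x| ≤ Bv) (lam : ℝ)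
    (t : ℕ) :
    autocov κ π (fun s => u s + lam * v s) t
      = autocov κ π u t + 2 * lam * ∫ x, u x * (kop κ)^[t] v x ∂π + lam ^ 2 * autocov κ π v t := by
  obtain ⟨hUm, hUb⟩ := iterate_kop_bounded_measurable κ hu hBu t
  obtain ⟨hVm, hVb⟩ := iterate_kop_bounded_measurable κ hv hBv t
  have hlin : ∀ x, (kop κ)^[t] (fun s => u s + lam * v s) x = (kop κ)^[t] u x + lam * (kop κ)^[t] v x :=
    op_iterate_add_mul (K := kop κ) kop_opBdd kop_opLin lam t hu hv hBu hBv
  have hsymm : ∫ x, v x * (kop κ)^[t] u x ∂π = ∫ x, u x * (kop κ)^[t] v x ∂π :=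
    integral_mul_iterate_kop_comm_of_isReversible hrev t hv hu hBv hBu
  have hbd : ∀ {a b : Ω → ℝ} {Ba Bb : ℝ}, Measurable a → Measurable b → (∀ x, |a x| ≤ Ba) →
      (∀ x, |b x| ≤ Bb) → Integrable (fun x => a x * b x) π := by
    intro a b Ba Bb ha hb hBa hBb
    exact integrable_of_bounded π (ha.mul hb) (C := Ba * Bb) fun x => by
      rw [abs_mul]; exact mul_le_mul (hBa x) (hBb x) (abs_nonneg _) ((abs_nonneg _).trans (hBa x))
  have h1 : Integrable (fun x => u x * (kop κ)^[t] u x) π := hbd hu hUm hBu hUb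
  have h2 : Integrable (fun x => lam * (u x * (kop κ)^[t] v x)) π := (hbd hu hVm hBu hVb).const_mul lam
  have h3 : Integrable (fun x => lam * (v x * (kop κ)^[t] u x)) π := (hbd hv hUm hBv hUb).const_mul lam
  have h4 : Integrable (fun x => lam ^ 2 * (v x * (kop κ)^[t] v x)) π :=
    (hbd hv hVm hBv hVb).const_mul (lam ^ 2)
  have h12 : Integrable (fun x => u x * (kop κ)^[t] u x + lam * (u x * (kop κ)^[t] v x)) π :=
    h1.add h2
  have h123 : Integrable (fun x => u x * (kop κ)^[t] u x + lam * (u x * (kop κ)^[t] v x)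
      + lam * (v x * (kop κ)^[t] u x)) π := h12.add h3
  have hpt : ∀ x, (u x + lam * v x) * ((kop κ)^[t] u x + lam * (kop κ)^[t] v x)
      = u x * (kop κ)^[t] u x + lam * (u x * (kop κ)^[t] v x) + lam * (v x * (kop κ)^[t] u x)
        + lam ^ 2 * (v x * (kop κ)^[t] v x) := fun x => by ring
  unfold autocov
  calc ∫ x, (u x + lam * v x) * (kop κ)^[t] (fun s => u s + lam * v s) x ∂π
      = ∫ x, (u x * (kop κ)^[t] u x + lam * (u x * (kop κ)^[t] v x) + lam * (v x * (kop κ)^[t] u x)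
          + lam ^ 2 * (v x * (kop κ)^[t] v x)) ∂π :=
        integral_congr_ae (ae_of_all _ fun x => by dsimp only; rw [hlin x, hpt x])
    _ = ∫ x, u x * (kop κ)^[t] u x ∂π + lam * ∫ x, u x * (kop κ)^[t] v x ∂π
          + lam * ∫ x, v x * (kop κ)^[t] u x ∂π + lam ^ 2 * ∫ x, v x * (kop κ)^[t] v x ∂π := by
        rw [integral_add h123 h4, integral_add h12 h3, integral_add h1 h2,
          integral_const_mul, integral_const_mul, integral_const_mul]
    _ = _ := by rw [hsymm]; ring

/-- **One-step positivity propagates to every lag**: if `∫ g · kop κ g dπ ≥ 0` for every bounded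
measurable `g` (a POSITIVE reversible kernel), then `0 ≤ autocov κ π g t` for every `t`. -/
theorem autocov_nonneg_of_kop_nonneg (hrev : Kernel.IsReversible κ π)
    (hpos : ∀ ⦃g : Ω → ℝ⦄ ⦃B : ℝ⦄, Measurable g → (∀ x, |g x| ≤ B) → 0 ≤ ∫ x, g x * kop κ g x ∂π)
    {g : Ω → ℝ} (hg : Measurable g) {B : ℝ} (hB : ∀ x, |g x| ≤ B) (t : ℕ) :
    0 ≤ autocov κ π g t := by
  obtain ⟨m, rfl | rfl⟩ := Nat.even_or_odd' t
  · exact autocov_even_nonneg_of_isReversible hrev hg hB m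
  · obtain ⟨hMm, hMb⟩ := iterate_kop_bounded_measurable κ hg hB m
    have two := op_two_time (μ := π) (w := fun _ : Ω => (1 : ℝ)) (K := kop κ) kop_opBdd
      (kop_opSymm hrev) hg hB m (m + 1)
    rw [show m + (m + 1) = 2 * m + 1 by ring, integral_mul_iterate_kop_mul_one] at two
    rw [← two]
    simp only [mul_one, Function.iterate_succ_apply']
    exact hpos hMm hMb

/-- **CAUCHY–SCHWARZ AT LAG `t`.**  For a `π`-reversible Markov kernel whose lag-`t` form is positive
semidefinite (`0 ≤ autocov κ π g t` for every bounded measurable `g`) and bounded measurable `u, v`: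
`(∫ u · (kop κ)^[t] v dπ)² ≤ autocov κ π u t · autocov κ π v t`. -/
theorem sq_crossCov_le_of_autocov_nonneg (hrev : Kernel.IsReversible κ π) {t : ℕ}
    (hpos : ∀ ⦃g : Ω → ℝ⦄ ⦃B : ℝ⦄, Measurable g → (∀ x, |g x| ≤ B) → 0 ≤ autocov κ π g t)
    {u v : Ω → ℝ} (hu : Measurable u) (hv : Measurable v) {Bu Bv : ℝ} (hBu : ∀ x, |u x| ≤ Bu)
    (hBv : ∀ x, |v x| ≤ Bv) :
    (∫ x, u x * (kop κ)^[t] v x ∂π) ^ 2 ≤ autocov κ π u t * autocov κ π v t := by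
  set b := ∫ x, u x * (kop κ)^[t] v x ∂π with hb
  have hquad : ∀ lam : ℝ, 0 ≤ autocov κ π v t * (lam * lam) + 2 * b * lam + autocov κ π u t := by
    intro lam
    have hm : Measurable fun s => u s + lam * v s := hu.add (measurable_const.mul hv)
    have hbd : ∀ x, |u x + lam * v x| ≤ Bu + |lam| * Bv := fun x => by
      have h1 : |lam * v x| ≤ |lam| * Bv := by
        rw [abs_mul]; exact mul_le_mul_of_nonneg_left (hBv x) (abs_nonneg _)
      exact (abs_add_le _ _).trans (add_le_add (hBu x) h1)
    have h0 := hpos hm hbd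
    rw [autocov_add_mul hrev hu hv hBu hBv lam t, ← hb] at h0
    nlinarith [h0]
  have hd := discrim_le_zero hquad
  rw [discrim] at hd
  nlinarith [hd]

/-- `|∫ u · (kop κ)^[t] v dπ| ≤ √(autocov κ π u t · autocov κ π v t)` under the same hypotheses. -/
theorem abs_crossCov_le_sqrt_of_autocov_nonneg (hrev : Kernel.IsReversible κ π) {t : ℕ}
    (hpos : ∀ ⦃g : Ω → ℝ⦄ ⦃B : ℝ⦄, Measurable g → (∀ x, |g x| ≤ B) → 0 ≤ autocov κ π g t)
    {u v : Ω → ℝ} (hu : Measurable u) (hv : Measurable v) {Bu Bv : ℝ} (hBu : ∀ x, |u x| ≤ Bu)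
    (hBv : ∀ x, |v x| ≤ Bv) :
    |∫ x, u x * (kop κ)^[t] v x ∂π| ≤ Real.sqrt (autocov κ π u t * autocov κ π v t) := by
  rw [← Real.sqrt_sq_eq_abs]
  exact Real.sqrt_le_sqrt (sq_crossCov_le_of_autocov_nonneg hrev hpos hu hv hBu hBv)

end Reversible

/-! ### The flow-MCMC kernel: every lag, every pair of observables -/

section IndepMH

variable {q : Measure Ω} [IsProbabilityMeasure q] {w : Ω → ℝ} {π : Measure Ω} [IsProbabilityMeasure π]

/-- **CROSS-COVARIANCE DOMINATION FOR THE FLOW-MCMC KERNEL.**  With the target `π = w · q` (`w > 0`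
measurable, `q`-integrable), for every lag `t` and every pair of bounded measurable observables:
`(∫ u · (kop K)^[t] v dπ)² ≤ autocov K π u t · autocov K π v t`, `K = indepMH q w`. -/
theorem indepMH_sq_crossCov_le (hw : Measurable w) (hw0 : ∀ x, 0 < w x) (hwi : Integrable w q)
    (hπ : (q.withDensity fun x => ENNReal.ofReal (w x)) = π) {u v : Ω → ℝ} (hu : Measurable u)
    (hv : Measurable v) {Bu Bv : ℝ} (hBu : ∀ x, |u x| ≤ Bu) (hBv : ∀ x, |v x| ≤ Bv) (t : ℕ) :
    (∫ x, u x * (kop (indepMH q w))^[t] v x ∂π) ^ 2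
      ≤ autocov (indepMH q w) π u t * autocov (indepMH q w) π v t := by
  haveI : Fact (Measurable w) := ⟨hw⟩
  have hrev : Kernel.IsReversible (indepMH q w) π := by rw [← hπ]; exact indepMH_isReversible hw hw0
  exact sq_crossCov_le_of_autocov_nonneg hrev
    (fun g B hg hB => indepMH_autocov_nonneg hw hw0 hwi hπ hg hB t) hu hv hBu hBv

/-- `|C_{uv}(t)| ≤ √(C_u(t) C_v(t))` for the flow-MCMC kernel. -/
theorem indepMH_abs_crossCov_le_sqrt (hw : Measurable w) (hw0 : ∀ x, 0 < w x) (hwi : Integrable w q)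
    (hπ : (q.withDensity fun x => ENNReal.ofReal (w x)) = π) {u v : Ω → ℝ} (hu : Measurable u)
    (hv : Measurable v) {Bu Bv : ℝ} (hBu : ∀ x, |u x| ≤ Bu) (hBv : ∀ x, |v x| ≤ Bv) (t : ℕ) :
    |∫ x, u x * (kop (indepMH q w))^[t] v x ∂π|
      ≤ Real.sqrt (autocov (indepMH q w) π u t * autocov (indepMH q w) π v t) := by
  rw [← Real.sqrt_sq_eq_abs]
  exact Real.sqrt_le_sqrt (indepMH_sq_crossCov_le hw hw0 hwi hπ hu hv hBu hBv t)

end IndepMH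

/-! ### The exact flow sampler on `SU(n)^E` — UNCONDITIONAL -/

section Lattice

open Literature.MathematicalPhysics.QuantumFieldTheory
open Literature.MathematicalPhysics.QuantumFieldTheory.Luscher2010
open Summit.Ventures.LatticeQCDFlow.TrivializingMaps
open scoped Matrix Matrix.Norms.Frobenius ContDiff

variable {d L n : ℕ} [NeZero L]

/-- **Cross-covariance domination for the exact flow sampler — UNCONDITIONAL.**  Under the hypotheses
of `Scoring.flowSampler_autocorrelation`: with the weight `w` of `flowSampler_exact_doeblin`
(`w · q = π := 𝒵⁻¹e^{−S}D[U]`, `K = indepMH q w` EXACT), for every lag `t` and every pair of bounded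
measurable observables `u, v`: `(∫ u · (kop K)^[t] v dπ)² ≤ autocov K π u t · autocov K π v t`. -/
theorem flowSampler_sq_crossCov_le (B : SuBasis n)
    {S : AmbConfig d L n → ℝ} (hS : ContDiff ℝ ∞ S) {F : ℝ → AmbConfig d L n → ℝ}
    (hF : ContDiff ℝ ∞ fun p : ℝ × AmbConfig d L n => F p.1 p.2)
    {Φ : ℝ → GaugeConfig d L (Matrix.specialUnitaryGroup (Fin n) ℂ) →
      GaugeConfig d L (Matrix.specialUnitaryGroup (Fin n) ℂ)}
    (hΦ : IsFlowMap (fun t W => -linkGrad B (F t) W) Φ) {c : ℝ → ℝ} {δ : ℝ}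
    (hδ : ∀ t ∈ Set.Icc (0 : ℝ) 1, ∀ U : GaugeConfig d L (Matrix.specialUnitaryGroup (Fin n) ℂ),
      |luscherL B S t (F t) (WilsonFlow.coeConfig U) - S (WilsonFlow.coeConfig U) - c t| ≤ δ)
    (q : Measure (GaugeConfig d L (Matrix.specialUnitaryGroup (Fin n) ℂ))) [IsProbabilityMeasure q]
    (hq : q = Measure.map (Φ 1) (trivialMeasure (Matrix.specialUnitaryGroup (Fin n) ℂ) d L)) :
    ∃ w : GaugeConfig d L (Matrix.specialUnitaryGroup (Fin n) ℂ) → ℝ, Measurable w ∧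
      (q.withDensity fun U => ENNReal.ofReal (w U)) =
        boltzmannMeasure (fun U : GaugeConfig d L (Matrix.specialUnitaryGroup (Fin n) ℂ) =>
          S (WilsonFlow.coeConfig U)) ∧
      Kernel.Invariant (indepMH q w)
        (boltzmannMeasure fun U : GaugeConfig d L (Matrix.specialUnitaryGroup (Fin n) ℂ) =>
          S (WilsonFlow.coeConfig U)) ∧
      ∀ (u v : GaugeConfig d L (Matrix.specialUnitaryGroup (Fin n) ℂ) → ℝ), Measurable u → Measurable v →
        ∀ Bu Bv : ℝ, (∀ U, |u U| ≤ Bu) → (∀ U, |v U| ≤ Bv) → ∀ t : ℕ,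
        let π := boltzmannMeasure fun U : GaugeConfig d L (Matrix.specialUnitaryGroup (Fin n) ℂ) =>
          S (WilsonFlow.coeConfig U)
        (∫ U, u U * (kop (indepMH q w))^[t] v U ∂π) ^ 2
          ≤ autocov (indepMH q w) π u t * autocov (indepMH q w) π v t := by
  obtain ⟨w, hw, hwlo, hwhi, hπ, hinv, -, -⟩ := flowSampler_exact_doeblin B hS hF hΦ hδ q hq
  have hS'c : Continuous fun U : GaugeConfig d L (Matrix.specialUnitaryGroup (Fin n) ℂ) =>
      S (WilsonFlow.coeConfig U) := hS.continuous.comp WilsonFlow.continuous_coeConfig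
  haveI := isProbabilityMeasure_boltzmannMeasure (d := d) (L := L) hS'c
  have hw0 : ∀ U, 0 < w U := fun U => (Real.exp_pos _).trans_le (hwlo U)
  have hwi : Integrable w q := integrable_of_bounded q hw (C := Real.exp (2 * δ)) fun U => by
    rw [abs_of_pos (hw0 U)]; exact hwhi U
  exact ⟨w, hw, hπ, hinv, fun u v hu hv Bu Bv hBu hBv t =>
    indepMH_sq_crossCov_le hw hw0 hwi hπ hu hv hBu hBv t⟩

end Lattice

end Summit.Ventures.LatticeQCDFlow.Scoring

end
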